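import Summits.AtomisticToContinuum.Crystallization.Theorems.ReggeStarCoercivityDefectFreeCrystallizesDevelopmentSteps1
import Summits.AtomisticToContinuum.Crystallization.Theorems.ReggeStarCoercivityDefectFreeCrystallizesDevelopmentSteps2
import Summits.AtomisticToContinuum.Crystallization.Theorems.ReggeStarCoercivityDefectFreeCrystallizesDevelopmentSteps3
import Summits.AtomisticToContinuum.Crystallization.Theorems.ReggeStarCoercivityDefectFreeCrystallizesDevelopmentVinv
import Summits.AtomisticToContinuum.Crystallization.Theorems.ReggeStarCoercivityDefectFreeCrystallizesDevelopmentAttach1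
import Summits.AtomisticToContinuum.Crystallization.Theorems.ReggeStarCoercivityDefectFreeCrystallizesDevelopmentAttach2
import Summits.AtomisticToContinuum.Crystallization.Theorems.ReggeStarCoercivityDefectFreeCrystallizesDevelopmentComm1
import Summits.AtomisticToContinuum.Crystallization.Theorems.ReggeStarCoercivityDefectFreeCrystallizesDevelopmentVComm1
import Summits.AtomisticToContinuum.Crystallization.Theorems.PalmUnimodularRigidityShellsToBarlowChartTransportVComm2

/-!
# Commutation of `V⁻¹` with `I` and `J` (part 2/3) (port to the abstract `1/20` chart clauses)

Port of `Theorems/PalmUnimodularRigidityShellsToBarlowChartTransportVComm2.lean` (crux 9227, line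
`develop-the-model-growth-descent`) to the ABSTRACT chart clauses of line `palm-good-law` of crux
stmt-AtomisticToContinuum-13603 (stub R1a4 `stub_combinatorialDevelopment`): the integer-chart hypothesis
`hch : ∀ z ∈ S, IsZChart S z …` is replaced by the section hypothesis `hch` = (pattern `fcc3Int`/`hcpInt`,
labelling `nb z` bijective onto the bonded neighbours, exact links) at every site ∧ the transfer identity for
every bonded pair; statements and proofs are otherwise verbatim (the transports `Istep, …, frameAt` and the
pattern facts `TransportPatterns*` are reused by name).  All `[folklore]` (HalesDSP2012 §1.3).
-/

noncomputable section

namespace Summit.AtomisticToContinuum.Crystallization.Theorems.PalmGoodLaw.Development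

open Literature.Geometry.DiscreteGeometry Literature.MathematicalPhysics.StatisticalMechanics
open Summit.AtomisticToContinuum.Crystallization.Theorems.ShellsToBarlowChartNegative
open Summit.AtomisticToContinuum.Crystallization.Theorems.PalmUnimodularRigidityShellsToBarlowChart

variable {S : Set (EuclideanSpace ℝ (Fin 3))} {Pc : (EuclideanSpace ℝ (Fin 3)) → Finset (Fin 3 → ℤ)}
  {nb : (EuclideanSpace ℝ (Fin 3)) → (Fin 3 → ℤ) → (EuclideanSpace ℝ (Fin 3))}
  (hch : (∀ z ∈ S, (Pc z = fcc3Int ∨ Pc z = hcpInt) ∧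
      Set.BijOn (nb z) (↑(Pc z) : Set (Fin 3 → ℤ)) {y | y ∈ S ∧ (0 < dist z y ∧ dist z y ≤ 28 / 25)} ∧
      (∀ t ∈ Pc z, ∀ t' ∈ Pc z,
        ((0 < dist (nb z t) (nb z t') ∧ dist (nb z t) (nb z t') ≤ 28 / 25) ↔ sqNormInt (t - t') = 18))) ∧
    (∀ x ∈ S, ∀ y ∈ S, (0 < dist x y ∧ dist x y ≤ 28 / 25) →
      ∀ (z z' : EuclideanSpace ℝ (Fin 3)) (t t' u u' : Fin 3 → ℤ),
        ((t = 0 ∧ z = x) ∨ (t ∈ Pc x ∧ z = nb x t)) → ((t' = 0 ∧ z' = x) ∨ (t' ∈ Pc x ∧ z' = nb x t')) →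
        ((u = 0 ∧ z = y) ∨ (u ∈ Pc y ∧ z = nb y u)) → ((u' = 0 ∧ z' = y) ∨ (u' ∈ Pc y ∧ z' = nb y u')) →
        sqNormInt (u - u') = sqNormInt (t - t')))

include hch in
/-- **`V⁻¹ ∘ I`, collinearity.**  With `d = (V⁻¹ g).pt` and `d₁ = (V⁻¹ (I g)).pt`, the label of
`d` at `d₁` is `−(V⁻¹ (I g)).t₁`. [folklore] -/
theorem VinvStep_Istep_back {x : (EuclideanSpace ℝ (Fin 3))} (hx : x ∈ S) {t₁ t₂ : Fin 3 → ℤ} {U : Finset (Fin 3 → ℤ)} (hU : IsFrame (Pc x) t₁ t₂ U) (hI : IsFrame (Pc (nb x t₁)) (Istep Pc nb ⟨x, t₁, t₂, U⟩).t₁ (Istep Pc nb ⟨x, t₁, t₂, U⟩).t₂ (Istep Pc nb ⟨x, t₁, t₂, U⟩).U) (hJ : IsFrame (Pc (nb x t₂)) (Jstep Pc nb ⟨x, t₁, t₂, U⟩).t₁ (Jstep Pc nb ⟨x, t₁, t₂, U⟩).t₂ (Jstep Pc nb ⟨x, t₁, t₂, U⟩).U) (hIi : IsFrame (Pc (nb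 x (-t₁))) (IinvStep Pc nb ⟨x, t₁, t₂, U⟩).t₁ (IinvStep Pc nb ⟨x, t₁, t₂, U⟩).t₂ (IinvStep Pc nb ⟨x, t₁, t₂, U⟩).U) (hJi : IsFrame (Pc (nb x (-t₂))) (JinvStep Pc nb ⟨x, t₁, t₂, U⟩).t₁ (JinvStep Pc nb ⟨x, t₁, t₂, U⟩).t₂ (JinvStep Pc nb ⟨x, t₁, t₂, U⟩).U) (hII : IsFrame (Pc (nb (nb x t₁) (Istep Pc nb ⟨x, t₁, t₂, U⟩).t₁)) (Istep Pc nb (Istep Pc nb ⟨x, t₁, t₂, U⟩)).t₁ (Istep Pc nb (Istep Pc nb ⟨x, t₁, t₂, U⟩)).t₂ (Istep Pc nb (Istep Pc nb ⟨x, t₁, t₂, U⟩)).U) (hJI : IsFrame (Pc (nb (nb x t₁) (Istep Pc nb ⟨x, t₁, t₂, U⟩).t₂)) (Jstep Pc nb (Istep Pc nb ⟨x, t₁, t₂, U⟩)).t₁ (Jstep Pc nb (Istep Pc nb ⟨x, t₁, t₂, U⟩)).t₂ (Jstep Pc nb (Istep Pc nb ⟨x, t₁, t₂, U⟩)).U)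 (hIiI : IsFrame (Pc (nb (nb x t₁) (-(Istep Pc nb ⟨x, t₁, t₂, U⟩).t₁))) (IinvStep Pc nb (Istep Pc nb ⟨x, t₁, t₂, U⟩)).t₁ (IinvStep Pc nb (Istep Pc nb ⟨x, t₁, t₂, U⟩)).t₂ (IinvStep Pc nb (Istep Pc nb ⟨x, t₁, t₂, U⟩)).U) (hJiI : IsFrame (Pc (nb (nb x t₁) (-(Istep Pc nb ⟨x, t₁, t₂, U⟩).t₂))) (JinvStep Pc nb (Istep Pc nb ⟨x, t₁, t₂, U⟩)).t₁ (JinvStep Pc nb (Istep Pc nb ⟨x, t₁, t₂, U⟩)).t₂ (JinvStep Pc nb (Istep Pc nb ⟨x, t₁, t₂, U⟩)).U) : zlab Pc nb (VinvStep Pc nb (Istep Pc nb ⟨x, t₁, t₂, U⟩)).pt (VinvStep Pc nb ⟨x, t₁, t₂, U⟩).pt = -(VinvStep Pc nb (Istep Pc nb ⟨x, t₁, t₂, U⟩)).t₁ ∧ nb (VinvStep Pc nb (Istep Pc nb ⟨x, t₁, t₂, U⟩)).pt (-(VinvStep Pc nb (Istep Pc nb ⟨x, t₁, t₂, U⟩)).t₁)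 = (VinvStep Pc nb ⟨x, t₁, t₂, U⟩).pt := by
  have hregI := hregI_of_valid (Pc := Pc) (nb := nb) hI
  obtain ⟨hyS, hbxy, hwP, hwx, -, -, -, -, -, -, -, hframe, hparI, -⟩ := Istep_spec hch hx hU hregI
  obtain ⟨hd'L, hdS, hbd, hξP, hξx, hframeVi, -, hbr⟩ := VinvStep_spec hch hx hU hI hJ hIi hJi
  obtain ⟨hpt, hbdd₁, hθ⟩ := VinvStep_Istep_pt hch hx hU hI hJ hIi hJi
  have hPx := pattern_cases hch hx
  have hPy := pattern_cases hch hyS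
  obtain ⟨h12, hhex, hUP, -, -⟩ := id hU
  have ht₁ : t₁ ∈ Pc x := hhex (mem_hexLabels_iff.2 (Or.inl rfl))
  have ht₂ : t₂ ∈ Pc x := hhex (mem_hexLabels_iff.2 (Or.inr (Or.inl rfl)))
  set d' := apexOf t₁ t₂ (lowerCap (Pc x) t₁ t₂ U) with hd'_def
  have hd'P : d' ∈ Pc x := (mem_lowerCap_iff.1 hd'L).1
  have hd'hex : d' ∉ hexLabels t₁ t₂ := (mem_lowerCap_iff.1 hd'L).2.1
  have hVpt : (VinvStep Pc nb ⟨x, t₁, t₂, U⟩).pt = nb x d' := rfl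
  rw [hVpt] at *
  set d := nb x d' with hd_def
  -- the frame `I g = ⟨y, a', b', U'⟩` and `V⁻¹` there
  set a' := (Istep Pc nb ⟨x, t₁, t₂, U⟩).t₁ with ha'
  set b' := (Istep Pc nb ⟨x, t₁, t₂, U⟩).t₂ with hb'
  set U' := (Istep Pc nb ⟨x, t₁, t₂, U⟩).U with hU'
  have hIeq : Istep Pc nb ⟨x, t₁, t₂, U⟩ = ⟨nb x t₁, a', b', U'⟩ := rfl
  rw [hIeq] at hII hJI hIiI hJiI hpt hbdd₁ hθ ⊢
  obtain ⟨hdL'L, hd₁S, hbyd₁, hξ'P, hξ'y, hframeVi', -, hbr'⟩ :=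
    VinvStep_spec hch hyS hframe hII hJI hIiI hJiI
  obtain ⟨h12', hhex', hUP', -, -⟩ := id hframe
  have ha'P : a' ∈ Pc (nb x t₁) := hhex' (mem_hexLabels_iff.2 (Or.inl rfl))
  have hb'P : b' ∈ Pc (nb x t₁) := hhex' (mem_hexLabels_iff.2 (Or.inr (Or.inl rfl)))
  set dL' := apexOf a' b' (lowerCap (Pc (nb x t₁)) a' b' U') with hdL'_def
  have hdL'P : dL' ∈ Pc (nb x t₁) := (mem_lowerCap_iff.1 hdL'L).1
  have hV'pt : (VinvStep Pc nb ⟨nb x t₁, a', b', U'⟩).pt = nb (nb x t₁) dL' := rfl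
  rw [hV'pt] at *
  set d₁ := nb (nb x t₁) dL' with hd₁_def
  set τ₁'' := (VinvStep Pc nb ⟨nb x t₁, a', b', U'⟩).t₁ with hτ₁''_def
  have hPd₁ := pattern_cases hch hd₁S
  have hτ₁''P : τ₁'' ∈ Pc d₁ := hframeVi'.2.1 (mem_hexLabels_iff.2 (Or.inl rfl))
  have hnτ₁''P : -τ₁'' ∈ Pc d₁ :=
    hframeVi'.2.1 (mem_hexLabels_iff.2 (Or.inr (Or.inr (Or.inr (Or.inl rfl)))))
  have Dτ₁'' : sqNormInt τ₁'' = 18 := (wsqNormInt_eq hch hd₁S) hτ₁''P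
  have hα := zlab_spec hch hd₁S hdS (bond_symm hbdd₁)
  rcases hbr with ⟨hlp, hUd, hnI, -, hLeq⟩ | ⟨hlp, hUd, hnI, -, hLeq⟩
  · /- letter below `+1`: `d₁ = nb x (d' + t₁)`; the upper cap of `d₁` contains the label of `x` -/
    obtain ⟨hlp', hatt, -⟩ := attach_lower_I_pos hch hx hU hlp hregI
    rw [hIeq] at hatt
    rcases hbr' with ⟨-, hUd₁, hnI', -, -⟩ | ⟨hlp'', -, -, -, -⟩
    swap
    · rw [hlp'] at hlp''; norm_num at hlp''
    obtain ⟨-, -, -, hd1, hd2, -⟩ := pos_form_of_lowerParity hPx hU hlp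
    have hd₁x : nb x (d' + t₁) = d₁ := hatt.symm
    have hyx : nb (nb x t₁) (-a') = x := by
      show nb (nb x t₁) (-(-zlab Pc nb (nb x t₁) x)) = x
      rw [neg_neg]; exact hwx
    have hη'P : zlab Pc nb d₁ (nb x t₁) - τ₁'' ∈ Pc d₁ := hframeVi'.2.2.1 (by rw [hUd₁]; simp)
    have hη' : zlab Pc nb d₁ x = zlab Pc nb d₁ (nb x t₁) - τ₁'' := by
      have h : zlab Pc nb d₁ (nb (nb x t₁) (-a')) = zlab Pc nb d₁ (nb x t₁) - τ₁'' := by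
        rw [← hnI']; exact zlab_nb hch hd₁S hη'P
      rwa [hyx] at h
    have hbxd₁ : 0 < dist x d₁ ∧ dist x d₁ ≤ 28 / 25 := by
      rw [← hd₁x]; exact (nb_mem hch hx hd1).2
    have hbd₁d : 0 < dist d₁ (nb x d') ∧ dist d₁ (nb x d') ≤ 28 / 25 := bond_symm hbdd₁
    have hbd₁y : 0 < dist d₁ (nb x t₁) ∧ dist d₁ (nb x t₁) ≤ 28 / 25 := bond_symm hbyd₁
    have Dαη' : sqNormInt (zlab Pc nb d₁ d - zlab Pc nb d₁ x) = 18 := by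
      rw [hd_def, transfer_nb_centre hch hx hd₁S hbxd₁ hd'P hbd₁d]
      exact (wsqNormInt_eq hch hx) hd'P
    have Dαξ' : sqNormInt (zlab Pc nb d₁ d - zlab Pc nb d₁ (nb x t₁)) = 54 := by
      rw [hd_def, transfer_nb_nb hch hx hd₁S hbxd₁ hd'P ht₁ hbd₁d hbd₁y, sqNormInt_sub_comm]
      exact (dist_oddCap (Pc x) hPx t₁ ht₁ t₂ ht₂ d' hd'P h12 hhex hd'hex hd1 hd2).2.2.1
    have hαeq : zlab Pc nb d₁ d = -τ₁'' := by
      have h := label_third_vertex (Pc d₁) hPd₁ (zlab Pc nb d₁ (nb x t₁)) hξ'P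
        (zlab Pc nb d₁ (nb x t₁) - τ₁'') hη'P _ hα.1
        (by rw [show zlab Pc nb d₁ (nb x t₁) - (zlab Pc nb d₁ (nb x t₁) - τ₁'') = τ₁'' by abel]
            exact Dτ₁'')
        (by rw [← hη']; exact Dαη') Dαξ'
        (by rw [show zlab Pc nb d₁ (nb x t₁) - τ₁'' - zlab Pc nb d₁ (nb x t₁) = -τ₁'' by abel]
            exact hnτ₁''P)
      rw [h]; abel
    refine ⟨hαeq, ?_⟩
    rw [← hαeq]; exact hα.2
  · /- letter below `−1`: `d = nb y (dL' − a')`; the upper cap of `d₁` contains the label of `IIx` -/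
    obtain ⟨hlp', hatt, -⟩ := attach_lower_I_neg hch hx hU hlp hregI
    rw [hIeq] at hatt
    rcases hbr' with ⟨hlp'', -, -, -, -⟩ | ⟨-, hUd₁, hnI', -, -⟩
    · rw [hlp'] at hlp''; norm_num at hlp''
    obtain ⟨-, -, hdL'hex, hd1', hd2', -⟩ := neg_form_of_lowerParity hPy hframe hlp'
    have hdy : nb (nb x t₁) (dL' - a') = d := hatt
    have hη'P : zlab Pc nb d₁ (nb x t₁) + τ₁'' ∈ Pc d₁ := hframeVi'.2.2.1 (by rw [hUd₁]; simp)
    have hbd₁II : 0 < dist d₁ (nb (nb x t₁) a') ∧ dist d₁ (nb (nb x t₁) a') ≤ 28 / 25 := by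
      rw [← hnI']; exact (nb_mem hch hd₁S hη'P).2
    have hη' : zlab Pc nb d₁ (nb (nb x t₁) a') = zlab Pc nb d₁ (nb x t₁) + τ₁'' := by
      rw [← hnI']; exact zlab_nb hch hd₁S hη'P
    have hbd₁d : 0 < dist d₁ (nb (nb x t₁) (dL' - a')) ∧
        dist d₁ (nb (nb x t₁) (dL' - a')) ≤ 28 / 25 := by rw [hdy]; exact bond_symm hbdd₁
    have Dαξ' : sqNormInt (zlab Pc nb d₁ d - zlab Pc nb d₁ (nb x t₁)) = 18 := by
      have h := transfer_nb_centre hch hyS hd₁S hbyd₁ hd1' hbd₁d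
      rw [hdy] at h
      rw [h]; exact (wsqNormInt_eq hch hyS) hd1'
    have Dαη' : sqNormInt (zlab Pc nb d₁ d - zlab Pc nb d₁ (nb (nb x t₁) a')) = 54 := by
      have h := transfer_nb_nb hch hyS hd₁S hbyd₁ hd1' ha'P hbd₁d hbd₁II
      rw [hdy] at h
      rw [h]
      exact (dist_evenCap_ca (Pc (nb x t₁)) hPy a' ha'P b' hb'P dL' hdL'P h12' hhex' hdL'hex
        hd1' hd2').1
    have hαeq : zlab Pc nb d₁ d = -τ₁'' := by
      have h := label_third_vertex (Pc d₁) hPd₁ (zlab Pc nb d₁ (nb x t₁) + τ₁'') hη'P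
        (zlab Pc nb d₁ (nb x t₁)) hξ'P _ hα.1
        (by rw [show zlab Pc nb d₁ (nb x t₁) + τ₁'' - zlab Pc nb d₁ (nb x t₁) = τ₁'' by abel]
            exact Dτ₁'')
        Dαξ' (by rw [← hη']; exact Dαη')
        (by rw [show zlab Pc nb d₁ (nb x t₁) - (zlab Pc nb d₁ (nb x t₁) + τ₁'') = -τ₁'' by abel]
            exact hnτ₁''P)
      rw [h]; abel
    refine ⟨hαeq, ?_⟩
    rw [← hαeq]; exact hα.2

include hch in
/-- **`V⁻¹ ∘ I`, the second direction.**  With `d₁ = (V⁻¹ (I g)).pt` and `dJ = (V⁻¹ (J g)).pt`,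
the label of `dJ` at `d₁` is `(V⁻¹ (I g)).t₂ − (V⁻¹ (I g)).t₁`. [folklore] -/
theorem VinvStep_Istep_side {x : (EuclideanSpace ℝ (Fin 3))}
    (hx : x ∈ S) {t₁ t₂ : Fin 3 → ℤ} {U : Finset (Fin 3 → ℤ)} (hU : IsFrame (Pc x) t₁ t₂ U)
    (hI : IsFrame (Pc (nb x t₁)) (Istep Pc nb ⟨x, t₁, t₂, U⟩).t₁ (Istep Pc nb ⟨x, t₁, t₂, U⟩).t₂
      (Istep Pc nb ⟨x, t₁, t₂, U⟩).U)
    (hJ : IsFrame (Pc (nb x t₂)) (Jstep Pc nb ⟨x, t₁, t₂, U⟩).t₁ (Jstep Pc nb ⟨x, t₁, t₂, U⟩).t₂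
      (Jstep Pc nb ⟨x, t₁, t₂, U⟩).U)
    (hIi : IsFrame (Pc (nb x (-t₁))) (IinvStep Pc nb ⟨x, t₁, t₂, U⟩).t₁
      (IinvStep Pc nb ⟨x, t₁, t₂, U⟩).t₂ (IinvStep Pc nb ⟨x, t₁, t₂, U⟩).U)
    (hJi : IsFrame (Pc (nb x (-t₂))) (JinvStep Pc nb ⟨x, t₁, t₂, U⟩).t₁
      (JinvStep Pc nb ⟨x, t₁, t₂, U⟩).t₂ (JinvStep Pc nb ⟨x, t₁, t₂, U⟩).U)
    (hII : IsFrame (Pc (nb (nb x t₁) (Istep Pc nb ⟨x, t₁, t₂, U⟩).t₁))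
      (Istep Pc nb (Istep Pc nb ⟨x, t₁, t₂, U⟩)).t₁ (Istep Pc nb (Istep Pc nb ⟨x, t₁, t₂, U⟩)).t₂
      (Istep Pc nb (Istep Pc nb ⟨x, t₁, t₂, U⟩)).U)
    (hJI : IsFrame (Pc (nb (nb x t₁) (Istep Pc nb ⟨x, t₁, t₂, U⟩).t₂))
      (Jstep Pc nb (Istep Pc nb ⟨x, t₁, t₂, U⟩)).t₁ (Jstep Pc nb (Istep Pc nb ⟨x, t₁, t₂, U⟩)).t₂
      (Jstep Pc nb (Istep Pc nb ⟨x, t₁, t₂, U⟩)).U)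
    (hIiI : IsFrame (Pc (nb (nb x t₁) (-(Istep Pc nb ⟨x, t₁, t₂, U⟩).t₁)))
      (IinvStep Pc nb (Istep Pc nb ⟨x, t₁, t₂, U⟩)).t₁ (IinvStep Pc nb (Istep Pc nb ⟨x, t₁, t₂, U⟩)).t₂
      (IinvStep Pc nb (Istep Pc nb ⟨x, t₁, t₂, U⟩)).U)
    (hJiI : IsFrame (Pc (nb (nb x t₁) (-(Istep Pc nb ⟨x, t₁, t₂, U⟩).t₂)))
      (JinvStep Pc nb (Istep Pc nb ⟨x, t₁, t₂, U⟩)).t₁ (JinvStep Pc nb (Istep Pc nb ⟨x, t₁, t₂, U⟩)).t₂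
      (JinvStep Pc nb (Istep Pc nb ⟨x, t₁, t₂, U⟩)).U)
    (hcomm : Istep Pc nb (Jstep Pc nb ⟨x, t₁, t₂, U⟩) = Jstep Pc nb (Istep Pc nb ⟨x, t₁, t₂, U⟩)) :
    zlab Pc nb (VinvStep Pc nb (Istep Pc nb ⟨x, t₁, t₂, U⟩)).pt (VinvStep Pc nb (Jstep Pc nb ⟨x, t₁, t₂, U⟩)).pt =
        (VinvStep Pc nb (Istep Pc nb ⟨x, t₁, t₂, U⟩)).t₂ - (VinvStep Pc nb (Istep Pc nb ⟨x, t₁, t₂, U⟩)).t₁ ∧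
      (0 < dist (VinvStep Pc nb (Istep Pc nb ⟨x, t₁, t₂, U⟩)).pt (VinvStep Pc nb (Jstep Pc nb ⟨x, t₁, t₂, U⟩)).pt ∧
        dist (VinvStep Pc nb (Istep Pc nb ⟨x, t₁, t₂, U⟩)).pt (VinvStep Pc nb (Jstep Pc nb ⟨x, t₁, t₂, U⟩)).pt
          ≤ 28 / 25) := by
  have hregI := hregI_of_valid (Pc := Pc) (nb := nb) hI
  have hregJ := hregJ_of_valid (Pc := Pc) (nb := nb) hJ
  obtain ⟨hyS, hbxy, hwP, hwx, hvP, hvnb, -, -, -, hκ, -, hframe, hparI, -⟩ := Istep_spec hch hx hU hregI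
  obtain ⟨hyJS, -, -, -, -, -, -, -, -, -, -, hJframe, hparJ, -⟩ := Jstep_spec hch hx hU hregJ
  obtain ⟨hd'L, hdS, hbd, hξP, hξx, hframeVi, -, hbr⟩ := VinvStep_spec hch hx hU hI hJ hIi hJi
  have hPx := pattern_cases hch hx
  have hPy := pattern_cases hch hyS
  obtain ⟨h12, hhex, hUP, -, -⟩ := id hU
  have ht₁ : t₁ ∈ Pc x := hhex (mem_hexLabels_iff.2 (Or.inl rfl))
  have ht₂ : t₂ ∈ Pc x := hhex (mem_hexLabels_iff.2 (Or.inr (Or.inl rfl)))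
  have ht12 : t₁ - t₂ ∈ Pc x :=
    hhex (mem_hexLabels_iff.2 (Or.inr (Or.inr (Or.inr (Or.inr (Or.inr rfl))))))
  set d' := apexOf t₁ t₂ (lowerCap (Pc x) t₁ t₂ U) with hd'_def
  have hd'P : d' ∈ Pc x := (mem_lowerCap_iff.1 hd'L).1
  have hd'hex : d' ∉ hexLabels t₁ t₂ := (mem_lowerCap_iff.1 hd'L).2.1
  -- frames `I g`, `J g`
  set a' := (Istep Pc nb ⟨x, t₁, t₂, U⟩).t₁ with ha'
  set b' := (Istep Pc nb ⟨x, t₁, t₂, U⟩).t₂ with hb'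
  set U' := (Istep Pc nb ⟨x, t₁, t₂, U⟩).U with hU'
  have hIeq : Istep Pc nb ⟨x, t₁, t₂, U⟩ = ⟨nb x t₁, a', b', U'⟩ := rfl
  set aJ := (Jstep Pc nb ⟨x, t₁, t₂, U⟩).t₁ with haJ
  set bJ := (Jstep Pc nb ⟨x, t₁, t₂, U⟩).t₂ with hbJ_def
  set UJ := (Jstep Pc nb ⟨x, t₁, t₂, U⟩).U with hUJ
  have hJeq : Jstep Pc nb ⟨x, t₁, t₂, U⟩ = ⟨nb x t₂, aJ, bJ, UJ⟩ := rfl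
  rw [hIeq] at hII hJI hIiI hJiI hcomm ⊢
  rw [hJeq] at hcomm ⊢
  obtain ⟨hdL'L, hd₁S, hbyd₁, hξ'P, hξ'y, hframeVi', -, hbr'⟩ :=
    VinvStep_spec hch hyS hframe hII hJI hIiI hJiI
  obtain ⟨h12', hhex', hUP', -, -⟩ := id hframe
  have ha'P : a' ∈ Pc (nb x t₁) := hhex' (mem_hexLabels_iff.2 (Or.inl rfl))
  have hb'P : b' ∈ Pc (nb x t₁) := hhex' (mem_hexLabels_iff.2 (Or.inr (Or.inl rfl)))
  set dL' := apexOf a' b' (lowerCap (Pc (nb x t₁)) a' b' U') with hdL'_def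
  have hdL'P : dL' ∈ Pc (nb x t₁) := (mem_lowerCap_iff.1 hdL'L).1
  have hV'pt : (VinvStep Pc nb ⟨nb x t₁, a', b', U'⟩).pt = nb (nb x t₁) dL' := rfl
  rw [hV'pt] at *
  set d₁ := nb (nb x t₁) dL' with hd₁_def
  set τ₁'' := (VinvStep Pc nb ⟨nb x t₁, a', b', U'⟩).t₁ with hτ₁''_def
  set τ₂'' := (VinvStep Pc nb ⟨nb x t₁, a', b', U'⟩).t₂ with hτ₂''_def
  have hPd₁ := pattern_cases hch hd₁S
  obtain ⟨h12'', hhex'', -, -, -⟩ := id hframeVi'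
  have hτ21P : τ₂'' - τ₁'' ∈ Pc d₁ := hhex'' (mem_hexLabels_iff.2 (Or.inr (Or.inr (Or.inl rfl))))
  have Dτ12 : sqNormInt (τ₁'' - τ₂'') = 18 := h12''
  -- the point `dJ = (V⁻¹ (J g)).pt`
  set dJ' := apexOf aJ bJ (lowerCap (Pc (nb x t₂)) aJ bJ UJ) with hdJ'_def
  have hVJpt : (VinvStep Pc nb ⟨nb x t₂, aJ, bJ, UJ⟩).pt = nb (nb x t₂) dJ' := rfl
  rw [hVJpt]
  rcases hbr with ⟨hlp, -, -, -, -⟩ | ⟨hlp, -, -, -, -⟩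
  · /- letter below `+1`: everything is read in the chart of `x` -/
    rcases hbr' with ⟨-, hUd₁, hnI', hnJ', -⟩ | ⟨hlp'', -, -, -, -⟩
    swap
    · obtain ⟨hlp', -, -⟩ := attach_lower_I_pos hch hx hU hlp hregI
      rw [hIeq] at hlp'
      exact absurd (hlp'.symm.trans hlp'') (by norm_num)
    obtain ⟨-, -, -, hd1, hd2, hLeq⟩ := pos_form_of_lowerParity hPx hU hlp
    obtain ⟨-, hattI, -⟩ := attach_lower_I_pos hch hx hU hlp hregI
    obtain ⟨-, hattJ, -⟩ := attach_lower_J_pos hch hx hU hlp hregJ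
    rw [hIeq] at hattI
    rw [hJeq] at hattJ
    have hd₁x : nb x (d' + t₁) = d₁ := hattI.symm
    have hdJx : nb (nb x t₂) dJ' = nb x (d' + t₂) := hattJ
    rw [hdJx]
    have hyx : nb (nb x t₁) (-a') = x := by
      show nb (nb x t₁) (-(-zlab Pc nb (nb x t₁) x)) = x
      rw [neg_neg]; exact hwx
    have hyz : nb (nb x t₁) (-b') = nb x (t₁ - t₂) := by
      have e : -b' = zlab Pc nb (nb x t₁) (nb x (t₁ - t₂)) := by
        rw [hκ]
        show -(zlab Pc nb (nb x t₁) (nb x t₂) - zlab Pc nb (nb x t₁) x) = _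
        abel
      rw [e]
      exact (zlab_spec hch hyS (nb_mem hch hx ht12).1 ((bond_nb_iff hch hx ht₁ ht12).2
        (dist_hexagon (Pc x) hPx t₁ ht₁ t₂ ht₂ h12 hhex).2.2.2.2.2.1)).2
    have hη'P : zlab Pc nb d₁ (nb x t₁) - τ₁'' ∈ Pc d₁ := hframeVi'.2.2.1 (by rw [hUd₁]; simp)
    have hζ'P : zlab Pc nb d₁ (nb x t₁) - τ₂'' ∈ Pc d₁ := hframeVi'.2.2.1 (by rw [hUd₁]; simp)
    have hη' : zlab Pc nb d₁ x = zlab Pc nb d₁ (nb x t₁) - τ₁'' := by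
      have h : zlab Pc nb d₁ (nb (nb x t₁) (-a')) = zlab Pc nb d₁ (nb x t₁) - τ₁'' := by
        rw [← hnI']; exact zlab_nb hch hd₁S hη'P
      rwa [hyx] at h
    have hζ' : zlab Pc nb d₁ (nb x (t₁ - t₂)) = zlab Pc nb d₁ (nb x t₁) - τ₂'' := by
      have h : zlab Pc nb d₁ (nb (nb x t₁) (-b')) = zlab Pc nb d₁ (nb x t₁) - τ₂'' := by
        rw [← hnJ']; exact zlab_nb hch hd₁S hζ'P
      rwa [hyz] at h
    have hbxd₁ : 0 < dist x d₁ ∧ dist x d₁ ≤ 28 / 25 := by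
      rw [← hd₁x]; exact (nb_mem hch hx hd1).2
    have hbd₁dJ : 0 < dist d₁ (nb x (d' + t₂)) ∧ dist d₁ (nb x (d' + t₂)) ≤ 28 / 25 := by
      have := (bond_nb_iff hch hx hd1 hd2).2 (by
        rw [show d' + t₁ - (d' + t₂) = t₁ - t₂ by abel]; exact h12)
      rwa [hd₁x] at this
    have hbd₁z : 0 < dist d₁ (nb x (t₁ - t₂)) ∧ dist d₁ (nb x (t₁ - t₂)) ≤ 28 / 25 := by
      have h : 0 < dist d₁ (nb (nb x t₁) (-b')) ∧ dist d₁ (nb (nb x t₁) (-b')) ≤ 28 / 25 := by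
        rw [← hnJ']; exact (nb_mem hch hd₁S hζ'P).2
      rwa [hyz] at h
    have hdJS : nb x (d' + t₂) ∈ S := (nb_mem hch hx hd2).1
    have hβ := zlab_spec hch hd₁S hdJS hbd₁dJ
    have Dβη : sqNormInt (zlab Pc nb d₁ (nb x (d' + t₂)) - zlab Pc nb d₁ x) = 18 := by
      rw [transfer_nb_centre hch hx hd₁S hbxd₁ hd2 hbd₁dJ]; exact (wsqNormInt_eq hch hx) hd2
    have Dβζ : sqNormInt (zlab Pc nb d₁ (nb x (d' + t₂)) - zlab Pc nb d₁ (nb x (t₁ - t₂))) = 54 := by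
      rw [transfer_nb_nb hch hx hd₁S hbxd₁ hd2 ht12 hbd₁dJ hbd₁z]
      exact (dist_oddCap_cb (Pc x) hPx t₁ ht₁ t₂ ht₂ d' hd'P h12 hhex hd'hex hd1 hd2).2.2.2.2.2
    have hβeq : zlab Pc nb d₁ (nb x (d' + t₂)) = τ₂'' - τ₁'' := by
      have h := label_third_vertex (Pc d₁) hPd₁ (zlab Pc nb d₁ (nb x t₁) - τ₂'') hζ'P
        (zlab Pc nb d₁ (nb x t₁) - τ₁'') hη'P _ hβ.1
        (by rw [show zlab Pc nb d₁ (nb x t₁) - τ₂'' - (zlab Pc nb d₁ (nb x t₁) - τ₁'') = τ₁'' - τ₂'' by abel]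
            exact Dτ12)
        (by rw [← hη']; exact Dβη) (by rw [← hζ']; exact Dβζ)
        (by rw [show zlab Pc nb d₁ (nb x t₁) - τ₁'' - (zlab Pc nb d₁ (nb x t₁) - τ₂'') = τ₂'' - τ₁'' by abel]
            exact hτ21P)
      rw [h]; abel
    exact ⟨hβeq, hbd₁dJ⟩
  · /- letter below `−1`: everything is read in the chart of `x'' = JIx = nb y b'` -/
    obtain ⟨hlp', hattJI, hlabJI⟩ := attach_lower_I_neg hch hx hU hlp hregI
    rw [hIeq] at hlp' hattJI hlabJI
    rcases hbr' with ⟨hlp'', -, -, -, -⟩ | ⟨-, hUd₁, hnI', hnJ', -⟩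
    · rw [hlp'] at hlp''; norm_num at hlp''
    -- the frame `J (I g) = ⟨x'', a'', b'', U''⟩` and its lower cap
    set a'' := (Jstep Pc nb ⟨nb x t₁, a', b', U'⟩).t₁ with ha''
    set b'' := (Jstep Pc nb ⟨nb x t₁, a', b', U'⟩).t₂ with hb''
    set U'' := (Jstep Pc nb ⟨nb x t₁, a', b', U'⟩).U with hU''
    have hJIeq : Jstep Pc nb ⟨nb x t₁, a', b', U'⟩ = ⟨nb (nb x t₁) b', a'', b'', U''⟩ := rfl
    have hregJI := hregJ_of_valid (Pc := Pc) (nb := nb) hJI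
    obtain ⟨hx''S, hbyx'', hw''P, hw''y, hv''P, hv''nb, -, -, -, -, -, hframe'', -, -⟩ :=
      Jstep_spec hch hyS hframe hregJI
    have hPx'' := pattern_cases hch hx''S
    obtain ⟨h12x, hhexx, -, -, -⟩ := id hframe''
    have ha''P : a'' ∈ Pc (nb (nb x t₁) b') := hhexx (mem_hexLabels_iff.2 (Or.inl rfl))
    have hb''P : b'' ∈ Pc (nb (nb x t₁) b') := hhexx (mem_hexLabels_iff.2 (Or.inr (Or.inl rfl)))
    have hab''P : a'' - b'' ∈ Pc (nb (nb x t₁) b') :=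
      hhexx (mem_hexLabels_iff.2 (Or.inr (Or.inr (Or.inr (Or.inr (Or.inr rfl))))))
    -- `d₁ = nb x'' (dL'' − b'')` by the lower J-attachment at `I g`
    obtain ⟨hlpJI, hattJ, -⟩ := attach_lower_J_neg hch hyS hframe hlp' hregJI
    rw [hJIeq] at hlpJI hattJ
    obtain ⟨hdL''L, hdL''P, hdL''hex, hd1'', hd2'', hL''eq⟩ := neg_form_of_lowerParity hPx'' hframe'' hlpJI
    set dL'' := apexOf a'' b'' (lowerCap (Pc (nb (nb x t₁) b')) a'' b'' U'') with hdL''_def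
    have hd₁x'' : nb (nb (nb x t₁) b') (dL'' - b'') = d₁ := hattJ
    -- `dJ = nb x'' (dL'' − a'')` by the lower I-attachment at `J g` through the in-layer commutation
    obtain ⟨hlpJ, -, -⟩ := attach_lower_J_neg hch hx hU hlp hregJ
    rw [hJeq] at hlpJ
    have hpteq : nb (nb x t₂) aJ = nb (nb x t₁) b' := congrArg ZFrame.pt hcomm
    have hregIJ : Pc (nb (nb x t₂) aJ) = fcc3Int ∨ Pc (nb x t₂) = hcpInt ∨
        (-zlab Pc nb (nb (nb x t₂) aJ) (nb x t₂) ∈ Pc (nb (nb x t₂) aJ) ∧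
          -zlab Pc nb (nb (nb x t₂) aJ) (nb (nb x t₂) bJ) ∈ Pc (nb (nb x t₂) aJ)) := by
      apply hregI_of_valid (Pc := Pc) (nb := nb)
      rw [hcomm, hpteq]; exact hJI
    obtain ⟨-, hattI, -⟩ := attach_lower_I_neg hch hyJS hJframe hlpJ hregIJ
    rw [hcomm] at hattI
    rw [hpteq] at hattI
    have hdJx'' : nb (nb (nb x t₁) b') (dL'' - a'') = nb (nb x t₂) dJ' := hattI
    -- bonds at `x''`
    have hbd₁dJ : 0 < dist d₁ (nb (nb x t₂) dJ') ∧ dist d₁ (nb (nb x t₂) dJ') ≤ 28 / 25 := by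
      have := (bond_nb_iff hch hx''S hd2'' hd1'').2 (by
        rw [show dL'' - b'' - (dL'' - a'') = a'' - b'' by abel]; exact h12x)
      rwa [hd₁x'', hdJx''] at this
    have hbx''d₁ : 0 < dist (nb (nb x t₁) b') d₁ ∧ dist (nb (nb x t₁) b') d₁ ≤ 28 / 25 := by
      rw [← hd₁x'']; exact (nb_mem hch hx''S hd2'').2
    have hdJS : nb (nb x t₂) dJ' ∈ S := by rw [← hdJx'']; exact (nb_mem hch hx''S hd1'').1
    have hβ := zlab_spec hch hd₁S hdJS hbd₁dJ
    -- `ζ' = ξ' + τ₂''` labels `x''`, `η' = ξ' + τ₁''` labels `IIx = nb x'' (a'' − b'')`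
    have hζ'P : zlab Pc nb d₁ (nb x t₁) + τ₂'' ∈ Pc d₁ := hframeVi'.2.2.1 (by rw [hUd₁]; simp)
    have hη'P : zlab Pc nb d₁ (nb x t₁) + τ₁'' ∈ Pc d₁ := hframeVi'.2.2.1 (by rw [hUd₁]; simp)
    have hζ' : zlab Pc nb d₁ (nb (nb x t₁) b') = zlab Pc nb d₁ (nb x t₁) + τ₂'' := by
      rw [← hnJ']; exact zlab_nb hch hd₁S hζ'P
    have hη' : zlab Pc nb d₁ (nb (nb x t₁) a') = zlab Pc nb d₁ (nb x t₁) + τ₁'' := by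
      rw [← hnI']; exact zlab_nb hch hd₁S hη'P
    have hbd₁II : 0 < dist d₁ (nb (nb x t₁) a') ∧ dist d₁ (nb (nb x t₁) a') ≤ 28 / 25 := by
      rw [← hnI']; exact (nb_mem hch hd₁S hη'P).2
    have hIIx'' : nb (nb (nb x t₁) b') (a'' - b'') = nb (nb x t₁) a' := by
      have e : a'' - b'' = zlab Pc nb (nb (nb x t₁) b') (nb (nb x t₁) a') := by
        show (zlab Pc nb (nb (nb x t₁) b') (nb (nb x t₁) a') - zlab Pc nb (nb (nb x t₁) b') (nb x t₁)) -
          -zlab Pc nb (nb (nb x t₁) b') (nb x t₁) = _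
        abel
      rw [e]; exact hv''nb
    have Dβζ : sqNormInt (zlab Pc nb d₁ (nb (nb x t₂) dJ') - zlab Pc nb d₁ (nb (nb x t₁) b')) = 18 := by
      have h := transfer_nb_centre hch hx''S hd₁S hbx''d₁ hd1'' (by rw [hdJx'']; exact hbd₁dJ)
      rw [hdJx''] at h
      rw [h]; exact (wsqNormInt_eq hch hx''S) hd1''
    have Dβη : sqNormInt (zlab Pc nb d₁ (nb (nb x t₂) dJ') - zlab Pc nb d₁ (nb (nb x t₁) a')) = 54 := by
      have h := transfer_nb_nb hch hx''S hd₁S hbx''d₁ hd1'' hab''P (by rw [hdJx'']; exact hbd₁dJ)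
        (by rw [hIIx'']; exact hbd₁II)
      rw [hdJx'', hIIx''] at h
      rw [h]
      exact (dist_evenCap_ca (Pc (nb (nb x t₁) b')) hPx'' a'' ha''P b'' hb''P dL'' hdL''P h12x hhexx
        hdL''hex hd1'' hd2'').2.2.2.2.2
    have hβeq : zlab Pc nb d₁ (nb (nb x t₂) dJ') = τ₂'' - τ₁'' := by
      have h := label_third_vertex (Pc d₁) hPd₁ (zlab Pc nb d₁ (nb x t₁) + τ₁'') hη'P
        (zlab Pc nb d₁ (nb x t₁) + τ₂'') hζ'P _ hβ.1
        (by rw [show zlab Pc nb d₁ (nb x t₁) + τ₁'' - (zlab Pc nb d₁ (nb x t₁) + τ₂'') = τ₁'' - τ₂'' by abel]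
            exact Dτ12)
        (by rw [← hζ']; exact Dβζ) (by rw [← hη']; exact Dβη)
        (by rw [show zlab Pc nb d₁ (nb x t₁) + τ₂'' - (zlab Pc nb d₁ (nb x t₁) + τ₁'') = τ₂'' - τ₁'' by abel]
            exact hτ21P)
      rw [h]; abel
    exact ⟨hβeq, hbd₁dJ⟩

/-- Landing anchor of this helper file (registered on crux stmt-AtomisticToContinuum-13603 for the port of stub R1a4;
a label of the integer kissing pattern). [folklore] -/
theorem development_vcomm2_anchor : ![-3, 0, 3] ∈ hcpInt := by decide

end Summit.AtomisticToContinuum.Crystallization.Theorems.PalmGoodLaw.Development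

end
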